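import Literature.MathematicalPhysics.QuantumFieldTheory.Balaban1983to89.B5Symbol166Strip
import Literature.MathematicalPhysics.QuantumFieldTheory.Balaban1983to89.B5Symbol163

/-!
# `Balaban1983to89.B5Hk163Strip` — the (1.63) momentum multiplier of `H_k`, continued to a `k`-UNIFORM complex strip in a ZERO-FREE REGROUPED NORMAL FORM (analyticity input for the kernel of `H_k`, cell node X10)

T. Bałaban, *Propagators and renormalization transformations for lattice gauge theories. I*, Commun. Math.
Phys. **95**, 17–40 (1984) [`Balaban1984PropagatorsI`, cell paper B5], (1.61)–(1.63) p. 28 [PDF 12] (render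
`1984-cmp95-propagators-rt-I-p012-x2.png`, read as an image by this unit).  The display (1.63) gives two expressions
for `(H_kB)~_μ(p′+l)`; the SECOND one (typed verbatim, symbol-agnostically, as `B5Symbol163.second163`) reads
`Δ₀(p′)/Δ(p′+l)·\overline{u(p′+l)v_μ(p′+l)}·(Δ₀(p′)φ_μ(p′))⁻¹ B̃_μ(p′) + Σ_{l′≠l} ∂_μ(p′+l)\overline{u(p′+l)}|u(p′+l′)|²
/(Δ(p′+l)Δ(p′+l′))·Δ₀²(p′)·[|v_μ(p′+l′)|²/Δ(p′+l) − |v_μ(p′+l)|²/Δ(p′+l′)]·(Σ_{l″}|u(p′+l″)|²Δ₀²(p′)/Δ²(p′+l″))⁻¹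
·(Δ₀(p′)φ_μ(p′))⁻¹(Σ_ν|∂¹_ν(p′)|²/(Δ₀²(p′)φ_ν(p′)))⁻¹ Σ_λ \overline{∂¹_λ(p′)}/(Δ₀(p′)φ_λ(p′)) B̃_λ(p′)`, followed
verbatim by «This expression is well defined and bounded for all values of `l` and `p′`, including `p′ = 0` where it
is defined as a limit for `p′ → 0`.» (the next sentence, p. 28 bottom – p. 29, states the alias-sum property; it is
NOT reproduced here).  The METHOD continued here: B5 p. 38 [PDF 22], the sentence before (1.126) («… the analyticity
method of proving an exponential decay …»), as for (1.66) in `B5Symbol166Strip`.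

CITATION HEADER (lean-in-tree rule).  This module is a SUPPLEMENT, not a quotation: B5 prints neither a complex
continuation of (1.63) nor a strip width.  Everything below is `[folklore]` audit mathematics; `[cite: …]` tags mark
the location of printed TEXT only.  ABSOLUTE RULE honoured: no statement of the papers is used as a hypothesis;
the imports are kernel-proved tree modules only (`B5Symbol166Strip` ⇒ the whole b05 strip engine, `B5Symbol163` =
the typed display).  No constant below (`kappaY`, `kappaN`, `kappa163`, `CT163`, `M163`, …) is attributed to print.

THE PROBLEM AND THE REGROUPING.  Read factor by factor, (1.63) cannot be continued to any strip `|Im p′_ν| ≤ κ`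
uniformly in `k`: `Δ₀(p′)/Δ(p′+l)`, `(Δ₀φ_μ)⁻¹`, `ψ₂⁻¹ = (Σ_{l″}|u|²Δ₀²/Δ²(p′+l″))⁻¹` and `(Σ_ν|∂¹_ν|²/(Δ₀²φ_ν))⁻¹`
all carry the complex zeros of `Δ₀(p′) = Σ_ν 4sin²(p′_ν/2)` resp. `Δ(p′)` inside every strip
(`B4Strip.printed_factor_has_poles` is the sibling phenomenon for (1.45)).  But every power of `Δ₀(p′)` and of
`Δ(p′)` CANCELS in the assembled coefficient of `B̃_λ`.  With the b05 objects `Y_μ := B5Symbol166.Yc` (`= Δ(p′)φ_μ(p′)`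
on the torus, `B5Symbol166.Yc_ofReal`), `F := B5Symbol166.F66` (`E = Δ·F`, `E = Σ_ν S₁(p′_ν)Π_{ν′≠ν}Y_ν′`),
`𝒩 := B5Strip145.Ncal` (`= Δ²·Σ_{l″}|u(p′+l″)|²/Δ²(p′+l″)`), the coefficient of `B̃_λ(p′)` in `(H_kB)~_μ(p′+l)` is
(§2, `h163`)
  `h_{l;μλ}(p′) = δ_{μλ}·ū(p′+l)v̄_μ(p′+l)·ρ_l/Y_μ + ∂_μ(p′+l)ū(p′+l)·(Σ_{l′≠l}A_{l,l′})/𝒩 · (Π_νY_ν)/(Y_μF) · \overline{∂¹_λ}/Y_λ`,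
  `ρ_l = Δ(p′)/Δ(p′+l)` (`ρ_0 = 1`), `A_{l,l′} = |u(p′+l′)|²(|v_μ(p′+l′)|²T(l,l′) − |v_μ(p′+l)|²T(l′,l))`,
  `T(l,l′) = Δ²(p′)/(Δ²(p′+l)Δ(p′+l′))` with the cancellations at `l = 0` / `l′ = 0` performed symbolically,
whose only denominators are `Y_μ`, `Y_λ`, `F`, `𝒩` and the shifted `Δ(p′+l)`, `l ≠ 0` — all ZERO-FREE on a strip of
`d`-only width (§4).  The leaves `ū(p′+l)`, `v̄_μ(p′+l)`, `∂_μ(p′+l)`, `\overline{∂¹_λ}` are continued as ENTIRE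
functions (`uCbar`, `vCbar` = the geometric mean `(1/n)Σ_{j<n}e^{−ijη(p′_μ+l_μ)}` filling the removable singularity of
`\overline{∂¹_μ(p′)/∂_μ(p′+l)}`, `dC`, `B5Symbol166Strip.expFacNeg`), `|u|² ↦ B4Strip.U`, `|v_μ|² ↦ B4Strip.uFactor`.

CONTENT.
* §1 the entire leaves and their values on the torus: `dC_ofReal = dSym`, `vC_ofReal = vSym`, `vCbar_ofReal = conj vSym`,
  `uCbar_ofReal = conj uSym` (`B5Prop11Fiber`), and the telescoped product `dC·vCbar = W − W^{1−n}` (bounded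
  uniformly in `n` although `‖∂_μ(p′+l)‖ ∼ n`);
* §2 the regrouped symbol `rho`, `Tfac`, `Afac`, `headC`, `tailC`, `gdir`, `h163`;
* §3 **identification** `second163_eq_sum_h163`: on the Brillouin zone `s ∈ [−π,π]^d ∖ {0}`, for every `n ≥ 1`, `μ`,
  `l`, `B̃`: `B5Symbol163.second163` on the torus leaves (`u = uSym`, `v_μ = vSym`, `∂_μ = dSym`, `∂¹ = d1Sym`,
  `Δ(p′+l) = DeltaXir∘shiftr`, `Δ₀ = Delta1r`, `φ_μ = B5Bounds167Lattice.phi162`) `= Σ_λ h163 μ λ l (s)·B̃_λ`;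
* §4 **the zero-free strip**: `kappa163 d = min(kappa166 d, kappaY d, kappaN d)` (explicit, `d` only) with, on
  `Strip d κ`, `0 ≤ κ ≤ kappa163 d`, every `n ≥ 1`: `‖F‖ ≥ ((4/π²)^d)^d/2` (`B5Symbol166Strip.F66_lower`),
  `‖Y_λ‖ ≥ (4/π²)^{d+1}/2` (`Yc_lower`, new: real bound `Y_λ ≥ c_λ ≥ (4/π²)^{d+1}` + the Cauchy-estimate
  Im-Lipschitz lemma `B4StripCauchy.imLipschitz_of_fat` + `B4Strip.strip_lower_bound`), `‖𝒩‖ ≥ (4/π²)^d/2`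
  (`Ncal_lower` = `B5Strip145.Ncal_lower_of_ImLipschitz` + `B5Strip145Leaves.imLipschitzN_holds` with an explicit
  width), `‖Δ(p′+l)‖ ≥ 2` for `l ≠ 0` (`B4StripCauchy.norm_DeltaXi_shift_ge`): `denominators_lower`,
  `denominators_ne_zero`;
* §5 **holomorphy**: `differentiableAt_h163` — `p′ ↦ h163 μ λ l (p′)` is holomorphic (jointly on `ℂ^d`) at every
  point of the zero-free strip, every `n`, `μ`, `λ`, `l`;
* §6 **uniform bound**: `norm_h163_le` — `‖h163 μ λ l (p′)‖ ≤ M163 d` on the zero-free strip, for every `n ≥ 1`,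
  `μ`, `λ` and EVERY alias index `l` (explicit crude `d`-only constant; per-factor bounds `‖v̄C‖ ≤ 2`,
  `‖∂_μ(p′+l)v̄C_μ‖ ≤ 4`, `‖ρ_l‖ ≤ 8d+1`, `‖T‖ ≤ CT163 d`, `‖Σ_{l′}A‖ ≤ 132^d·264·CT163 d`).

HONEST SCOPE.  (i) No kernel / decay statement and no `StripRegular` package is made here.  Two inputs of the
position-space step remain for a successor: (a) the DECAY IN THE ALIAS INDEX `l` of `sup_strip‖h_{l;μλ}‖`
(summability over the `n^d` aliases uniformly in `n`; it needs the first-power decay of `|v̄C_ν(p′+l)|` in `l_ν`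
combined with `ρ_l`, cf. the printed sentence p. 28 bottom) — §6 bounds each alias term uniformly but claims no
decay; (b) the `2π`-TRANSLATION COVARIANCE across the strip sides, which for (1.63) is an alias RE-INDEXING
(`p′ ↦ p′ + 2πe_ν`, `l ↦ l − e_ν` keeps `p′ + l`), not a per-`l` periodicity as for the `l`-free (1.66) symbol
`W166`; the contour-shift engine for X10 therefore acts on the alias family / the fine-momentum function, not on a
single `StripRegular` multiplier.  (ii) The constants are crude worst-case products of the fat-region bounds; only
their dependence on `d` alone matters.  (iii) `U = 1` throughout, as in `B5Bounds167Lattice`; `n = L^k ≥ 1`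
arbitrary (`[NeZero n]`).  (iv) The identification §3 is stated on the punctured real zone `s ≠ 0` where the printed
expression is defined; `h163` itself is defined and holomorphic through `p′ = 0` (the printed «defined as a limit»).
Float cross-check of §2 against a direct evaluation of the printed (1.63): cell archive
`b2b-balaban-b05-g10/num/check163.py|.out` (6042 comparisons, d ∈ {2,3}, n ∈ {2,3,4}, max. rel. deviation 7.3e-12; the identity `dC·vCbar = W − W^{1−n}` and `E = Δ·F` at complex points to 3e-15).
Value = kernel certificate (the analytic half of the analyticity method for (1.63), answering cell GAPS row
G-ne2p2-6 (i) for X10), NOT summit progress.  Unit `b2b-balaban-b05-g10` (B05 cell, generation 10).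
-/

noncomputable section

open scoped BigOperators ComplexConjugate
open Finset Complex

namespace Literature.MathematicalPhysics.QuantumFieldTheory.Balaban1983to89.B5Hk163Strip

open Literature.MathematicalPhysics.QuantumFieldTheory.Balaban1983to89.B4Strip
open Literature.MathematicalPhysics.QuantumFieldTheory.Balaban1983to89.B4StripCauchy
open Literature.MathematicalPhysics.QuantumFieldTheory.Balaban1983to89.B5Prop11Leaves
open Literature.MathematicalPhysics.QuantumFieldTheory.Balaban1983to89.B5Prop11Fiber
open Literature.MathematicalPhysics.QuantumFieldTheory.Balaban1983to89.B5Bounds167Lattice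
open Literature.MathematicalPhysics.QuantumFieldTheory.Balaban1983to89.B5Symbol166
open Literature.MathematicalPhysics.QuantumFieldTheory.Balaban1983to89.B5Strip145
open Literature.MathematicalPhysics.QuantumFieldTheory.Balaban1983to89.B5Strip145Leaves
open Literature.MathematicalPhysics.QuantumFieldTheory.Balaban1983to89.B5Strip145Analytic
open Literature.MathematicalPhysics.QuantumFieldTheory.Balaban1983to89.B5Symbol166Strip
open Literature.MathematicalPhysics.QuantumFieldTheory.Balaban1983to89.B5Symbol163

variable {d : ℕ}

/-! ## §1. The complex one-variable leaves of (1.61)/(1.63) and their values at real momenta -/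

/-- `∂_μ(p′+l) = η⁻¹(e^{iη(p′_μ+l_μ)} − 1)`, `η = 1/n`, `l = 2πk`, continued to complex `p′` (entire).
[cite: Balaban1984PropagatorsI, (1.31) p.23 (text of the formula only)] [folklore] -/
def dC (n : ℕ) (k : Fin d → Fin n) (p : Fin d → ℂ) (μ : Fin d) : ℂ :=
  (n : ℂ) * (Complex.exp (shift n k p μ / n * I) - 1)

/-- the continuation of `v_μ(p′+l) = ∂¹_μ(p′)/∂_μ(p′+l)` (1.61) as the ENTIRE geometric mean
`(1/n) Σ_{j<n} e^{ijη(p′_μ+l_μ)}` (`e^{ip′_μ} − 1 = W^n − 1 = (W − 1)Σ_{j<n}W^j`, `W = e^{iη(p′_μ+l_μ)}`; the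
removable singularity of the quotient is filled). [cite: Balaban1984PropagatorsI, (1.61) p.28 (text only)] [folklore] -/
def vC (n : ℕ) (k : Fin d → Fin n) (p : Fin d → ℂ) (μ : Fin d) : ℂ :=
  (∑ j : Fin n, Complex.exp (shift n k p μ / n * I * ((j : ℕ) : ℂ))) / n

/-- the holomorphic continuation of `conj v_μ(p′+l)`: `(1/n) Σ_{j<n} e^{−ijη(p′_μ+l_μ)}` (entire). [folklore] -/
def vCbar (n : ℕ) (k : Fin d → Fin n) (p : Fin d → ℂ) (μ : Fin d) : ℂ :=
  (∑ j : Fin n, Complex.exp (-(shift n k p μ / n * I * ((j : ℕ) : ℂ)))) / n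

/-- the holomorphic continuation of `conj u(p′+l) = Π_μ conj v_μ(p′+l)` (entire). [folklore] -/
def uCbar (n : ℕ) (k : Fin d → Fin n) (p : Fin d → ℂ) : ℂ := ∏ μ, vCbar n k p μ

/-- the geometric mean in closed form: `(1/n)Σ_{j<n} W^j = (W^n − 1)/(n(W − 1))` off `W = 1`, `= 1` at `W = 1`.
[folklore] -/
theorem geomMean_eq (n : ℕ) [NeZero n] (W : ℂ) :
    (∑ j : Fin n, W ^ (j : ℕ)) / n
      = if (n : ℂ) * (W - 1) = 0 then 1 else (W ^ n - 1) / ((n : ℂ) * (W - 1)) := by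
  have hn : (n : ℂ) ≠ 0 := Nat.cast_ne_zero.mpr (NeZero.ne n)
  rw [Fin.sum_univ_eq_sum_range (fun j => W ^ j) n]
  by_cases hW : W = 1
  · subst hW
    simp [hn]
  · have hW1 : W - 1 ≠ 0 := sub_ne_zero.mpr hW
    rw [if_neg (mul_ne_zero hn hW1), geom_sum_eq hW n]
    field_simp

/-- the shifted coordinate at a real momentum. [folklore] -/
theorem shift_ofRealVec_apply (n : ℕ) (k : Fin d → Fin n) (s : Fin d → ℝ) (μ : Fin d) :
    shift n k (ofRealVec s) μ = ((shiftr n k s μ : ℝ) : ℂ) := by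
  rw [shift_ofReal]; rfl

/-- `e^{i(p′_μ + l_μ)} = e^{ip′_μ}` for `l_μ ∈ 2πℤ`. [folklore] -/
theorem exp_shiftr_mul_I (n : ℕ) (k : Fin d → Fin n) (s : Fin d → ℝ) (μ : Fin d) :
    Complex.exp (((shiftr n k s μ : ℝ) : ℂ) * I) = Complex.exp (((s μ : ℝ) : ℂ) * I) := by
  have h : ((shiftr n k s μ : ℝ) : ℂ) * I = ((s μ : ℝ) : ℂ) * I + ((k μ : ℕ) : ℂ) * (2 * Real.pi * I) := by
    simp only [shiftr]; push_cast; ring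
  rw [h, Complex.exp_add, Complex.exp_nat_mul_two_pi_mul_I, mul_one]

/-- on real momenta `dC = ∂_μ(p′+l)` (`B5Prop11Fiber.dSym`). [folklore] -/
theorem dC_ofReal (n : ℕ) (k : Fin d → Fin n) (s : Fin d → ℝ) (μ : Fin d) :
    dC n k (ofRealVec s) μ = dSym n k s μ := by
  unfold dC dSym
  rw [shift_ofRealVec_apply]
  push_cast
  ring_nf

/-- on real momenta `vC = v_μ(p′+l)` (`B5Prop11Fiber.vSym`, including the removable point). [folklore] -/
theorem vC_ofReal (n : ℕ) [NeZero n] (k : Fin d → Fin n) (s : Fin d → ℝ) (μ : Fin d) :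
    vC n k (ofRealVec s) μ = vSym n k s μ := by
  have hn : (n : ℂ) ≠ 0 := Nat.cast_ne_zero.mpr (NeZero.ne n)
  set W : ℂ := Complex.exp (((shiftr n k s μ / n : ℝ) : ℂ) * I) with hW
  have hθ : shift n k (ofRealVec s) μ / n * I = ((shiftr n k s μ / n : ℝ) : ℂ) * I := by
    rw [shift_ofRealVec_apply]; push_cast; ring
  have hvC : vC n k (ofRealVec s) μ = (∑ j : Fin n, W ^ (j : ℕ)) / n := by
    unfold vC
    rw [hθ]
    congr 1
    refine Finset.sum_congr rfl (fun j _ => ?_)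
    rw [hW, ← Complex.exp_nat_mul, mul_comm]
  have hWn : W ^ n = Complex.exp (((s μ : ℝ) : ℂ) * I) := by
    rw [hW, ← Complex.exp_nat_mul, ← exp_shiftr_mul_I n k s μ]
    congr 1
    push_cast
    field_simp
  have hd : dSym n k s μ = (n : ℂ) * (W - 1) := rfl
  have hd1 : d1Sym s μ = W ^ n - 1 := by rw [hWn]; rfl
  rw [hvC, geomMean_eq, vSym, hd, hd1]

/-- on real momenta `vCbar = conj v_μ(p′+l)`. [folklore] -/
theorem vCbar_ofReal (n : ℕ) [NeZero n] (k : Fin d → Fin n) (s : Fin d → ℝ) (μ : Fin d) :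
    vCbar n k (ofRealVec s) μ = conj (vSym n k s μ) := by
  rw [← vC_ofReal]
  unfold vC vCbar
  rw [map_div₀, map_natCast, map_sum]
  congr 1
  refine Finset.sum_congr rfl (fun j _ => ?_)
  rw [← Complex.exp_conj, shift_ofRealVec_apply]
  congr 1
  simp only [map_mul, map_natCast, map_div₀, Complex.conj_ofReal, Complex.conj_I]
  ring

/-- on real momenta `uCbar = conj u(p′+l)` (`B5Prop11Fiber.uSym`). [folklore] -/
theorem uCbar_ofReal (n : ℕ) [NeZero n] (k : Fin d → Fin n) (s : Fin d → ℝ) :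
    uCbar n k (ofRealVec s) = conj (uSym n k s) := by
  unfold uCbar uSym
  rw [map_prod]
  exact Finset.prod_congr rfl (fun μ _ => vCbar_ofReal n k s μ)

/-- the telescoped product `∂_μ(p′+l)·v̄C_μ = W − W^{1−n}`, `W = e^{iη(p_μ+l_μ)}` — BOUNDED on the strip uniformly
in `n` although `∂_μ(p′+l)` alone is of size `n`. [folklore] -/
theorem dC_mul_vCbar (n : ℕ) [NeZero n] (k : Fin d → Fin n) (p : Fin d → ℂ) (μ : Fin d) :
    dC n k p μ * vCbar n k p μ
      = Complex.exp (shift n k p μ / n * I) - Complex.exp (-(shift n k p μ / n * I * ((n : ℂ) - 1))) := by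
  have hn : (n : ℂ) ≠ 0 := Nat.cast_ne_zero.mpr (NeZero.ne n)
  unfold dC vCbar
  set z : ℂ := shift n k p μ / n * I with hz
  have hterm : ∀ j : ℕ, Complex.exp (-(z * (j : ℂ))) = (Complex.exp (-z)) ^ j := by
    intro j
    rw [← Complex.exp_nat_mul]
    ring_nf
  have hsum : ∑ j : Fin n, Complex.exp (-(z * ((j : ℕ) : ℂ))) = ∑ j ∈ range n, (Complex.exp (-z)) ^ j := by
    rw [← Fin.sum_univ_eq_sum_range (fun j => (Complex.exp (-z)) ^ j) n]
    exact Finset.sum_congr rfl (fun j _ => hterm j)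
  rw [hsum]
  have htel : (Complex.exp z - 1) * ∑ j ∈ range n, (Complex.exp (-z)) ^ j
      = Complex.exp z - Complex.exp (-z) ^ n * Complex.exp z := by
    have key : ∀ m : ℕ, (Complex.exp z - 1) * ∑ j ∈ range m, (Complex.exp (-z)) ^ j
        = Complex.exp z - Complex.exp (-z) ^ m * Complex.exp z := by
      intro m
      induction m with
      | zero => simp
      | succ m ih =>
        rw [Finset.sum_range_succ, mul_add, ih, pow_succ]
        have e1 : Complex.exp (-z) * Complex.exp z = 1 := by
          rw [← Complex.exp_add]; simp
        linear_combination (Complex.exp (-z) ^ m) * e1 - Complex.exp (-z) ^ m * Complex.exp (-z) * e1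
          + Complex.exp (-z) ^ m * Complex.exp (-z) * e1
    exact key n
  have hfin : Complex.exp (-z) ^ n * Complex.exp z = Complex.exp (-(z * ((n : ℂ) - 1))) := by
    rw [← Complex.exp_nat_mul, ← Complex.exp_add]
    congr 1
    ring
  calc (n : ℂ) * (Complex.exp z - 1) * ((∑ j ∈ range n, Complex.exp (-z) ^ j) / n)
      = (Complex.exp z - 1) * ∑ j ∈ range n, Complex.exp (-z) ^ j := by
        field_simp
    _ = Complex.exp z - Complex.exp (-(z * ((n : ℂ) - 1))) := by rw [htel, hfin]


/-! ## §2. The regrouped symbol (every `Δ₀(p′)` cancelled; only zero-free denominators remain) -/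

section Defs

variable (n : ℕ) [NeZero n]

/-- `ρ_l(p′) := Δ(p′)/Δ(p′+l)` for `l ≠ 0`, `ρ_0 := 1` (the combination `Δ₀/Δ(p′+l) · (Δ₀φ_μ)⁻¹ · (Δφ_μ)` of the
head term of (1.63) with both `Δ₀` AND the vanishing `Δ(p′)` divided out exactly). [folklore] -/
def rho (k : Fin d → Fin n) (p : Fin d → ℂ) : ℂ :=
  if k = fun _ => 0 then 1 else DeltaXi n 0 p / DeltaXi n 0 (shift n k p)

/-- `T(l,l′) := Δ²(p′)/(Δ²(p′+l)Δ(p′+l′))` with the cancellations at `l = 0` (`= 1/Δ(p′+l′)`) and at `l′ = 0`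
(`= Δ(p′)/Δ²(p′+l)`) performed symbolically (the value at `l = l′ = 0` is junk and never used). [folklore] -/
def Tfac (k k' : Fin d → Fin n) (p : Fin d → ℂ) : ℂ :=
  if k' = fun _ => 0 then DeltaXi n 0 p / DeltaXi n 0 (shift n k p) ^ 2
  else rho n k p ^ 2 / DeltaXi n 0 (shift n k' p)

/-- the alias summand `A_{l,l′} := |u(p′+l′)|²·(|v_μ(p′+l′)|²T(l,l′) − |v_μ(p′+l)|²T(l′,l))` = the printed
`|u(p′+l′)|²/(Δ(p′+l)Δ(p′+l′))·[|v_μ(p′+l′)|²/Δ(p′+l) − |v_μ(p′+l)|²/Δ(p′+l′)]` times `Δ²(p′)`, continued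
(`|u(p′+l′)|² ↦ U_{l′}`, `|v_μ(p′+l)|² ↦ uFactor(l_μ, p′_μ)`). [cite: Balaban1984PropagatorsI, (1.63) p.28 (text only)] [folklore] -/
def Afac (μ : Fin d) (k k' : Fin d → Fin n) (p : Fin d → ℂ) : ℂ :=
  U n k' p * (uFactor n (k' μ : ℕ) (p μ) * Tfac n k k' p - uFactor n (k μ : ℕ) (p μ) * Tfac n k' k p)

/-- the continued coefficient of `B̃_μ(p′)` in the head term of (1.63):
`ūC(p′+l) v̄C_μ(p′+l) ρ_l(p′) / Y_μ(p′)` (`Y_μ = B5Symbol166.Yc = Δφ_μ` on the reals). [folklore] -/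
def headC (μ : Fin d) (k : Fin d → Fin n) (p : Fin d → ℂ) : ℂ :=
  uCbar n k p * vCbar n k p μ * rho n k p / Yc n μ p

/-- the continued `λ`-independent prefix of the tail term of (1.63):
`∂_μ(p′+l) ūC(p′+l) · (Σ_{l′≠l} A_{l,l′}) / 𝒩(p′) · Π_ν Y_ν / (Y_μ F)` with `𝒩 = B5Strip145.Ncal`
(`= Δ²·Σ_{l″}|u(p′+l″)|²/Δ²(p′+l″)`, replacing `ψ₂⁻¹`) and `F = B5Symbol166.F66` (replacing
`(Δ₀φ_μ)⁻¹(Σ_ν|∂¹_ν|²/(Δ₀²φ_ν))⁻¹(Δ₀φ_λ)⁻¹`, via `E = Δ·F`). [folklore] -/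
def tailC (μ : Fin d) (k : Fin d → Fin n) (p : Fin d → ℂ) : ℂ :=
  dC n k p μ * uCbar n k p * (∑ k' ∈ univ.erase k, Afac n μ k k' p) / Ncal n p
    * ((∏ ν, Yc n ν p) / (Yc n μ p * F66 n p))

/-- the continued direction factor `conj ∂¹_λ(p′) / Y_λ(p′)` (`e^{−ip′_λ} − 1 = B5Symbol166Strip.expFacNeg`). [folklore] -/
def gdir (lam : Fin d) (p : Fin d → ℂ) : ℂ := expFacNeg lam p / Yc n lam p

/-- **THE CONTINUED (1.63) MULTIPLIER**: `h_{l;μλ}(p′)` = the coefficient of `B̃_λ(p′)` in `(H_kB)~_μ(p′+l)`,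
`= δ_{μλ}·headC + tailC·gdir_λ`, as a function of COMPLEX `p′`; its denominators are `Y_μ`, `Y_λ`, `F`, `𝒩`
and the shifted `Δ(p′+l)`, `l ≠ 0`, only (all zero-free on the strip of §4).
[cite: Balaban1984PropagatorsI, (1.63) p.28 (text of the formula only; regrouping ours)] [folklore] -/
def h163 (μ lam : Fin d) (k : Fin d → Fin n) (p : Fin d → ℂ) : ℂ :=
  (if lam = μ then headC n μ k p else 0) + tailC n μ k p * gdir n lam p

end Defs


/-! ## §3. Identification with the printed second expression of (1.63) on real momenta

On the Brillouin zone `p′ = s ∈ [−π,π]^d`, `s ≠ 0`, the typed printed expression `B5Symbol163.second163`,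
instantiated with the torus leaves of `B5Prop11Fiber` (`u(p′+l) = uSym`, `v_μ(p′+l) = vSym`, `∂_μ(p′+l) = dSym`,
`∂¹ = d1Sym`, `Δ(p′+l) = DeltaXir ∘ shiftr`, `Δ₀ = Delta1r`, `φ_μ = B5Bounds167Lattice.phi162`), equals
`Σ_λ h163 μ λ l (p′) B̃_λ`.  All algebra below is ours ([folklore]); the paper is cited for the TEXT of (1.63) only. -/

section Real

variable (n : ℕ) [NeZero n]

/-- `|u(p′+l)|²` on the torus is `normSq uSym`. [folklore] -/
theorem U_ofReal_normSq (hn : 1 ≤ n) (k : Fin d → Fin n) (s : Fin d → ℝ) (hs : ∀ ν, |s ν| ≤ Real.pi) :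
    U n k (ofRealVec s) = ((normSq (uSym n k s) : ℝ) : ℂ) := by
  rw [U_ofReal, Complex.normSq_eq_norm_sq, norm_uSym_sq n hn k s hs]

/-- `|v_μ(p′+l)|²` on the torus is `normSq vSym`. [folklore] -/
theorem uFactor_ofReal_normSq (hn : 1 ≤ n) (k : Fin d → Fin n) (s : Fin d → ℝ) (μ : Fin d)
    (hs : |s μ| ≤ Real.pi) :
    uFactor n (k μ : ℕ) (ofRealVec s μ) = ((normSq (vSym n k s μ) : ℝ) : ℂ) := by
  rw [show ofRealVec s μ = ((s μ : ℝ) : ℂ) from rfl, uFactor_ofReal, Complex.normSq_eq_norm_sq,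
    norm_vSym_sq n hn k s μ hs]

omit [NeZero n] in
/-- the shifted symbol on the torus is the real shifted symbol. [folklore] -/
theorem DeltaXi_shift_ofReal (k : Fin d → Fin n) (s : Fin d → ℝ) :
    DeltaXi n 0 (shift n k (ofRealVec s)) = ((DeltaXir n 0 (shiftr n k s) : ℝ) : ℂ) := by
  rw [shift_ofReal, DeltaXi_ofReal]

omit [NeZero n] in
/-- `S₁(p′_ν)` on the torus is `|∂¹_ν(p′)|²`. [folklore] -/
theorem S1_ofReal_normSq (s : Fin d → ℝ) (ν : Fin d) :
    S1 (ofRealVec s ν) = ((normSq (d1Sym s ν) : ℝ) : ℂ) := by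
  rw [S1_ofRealVec, Complex.normSq_eq_norm_sq, norm_d1Sym_sq]

omit [NeZero n] in
/-- `φ_μ` of `B5Symbol163` on the torus leaves is `B5Bounds167Lattice.phi162`. [folklore] -/
theorem phiSym_ofReal (s : Fin d → ℝ) (μ : Fin d) :
    phiSym (fun l : Fin d → Fin n => uSym n l s) (fun l => vSym n l s μ)
        (fun l => ((DeltaXir n 0 (shiftr n l s) : ℝ) : ℂ))
      = ((phi162 n μ s : ℝ) : ℂ) := by
  unfold phiSym phi162
  simp only [Complex.normSq_eq_norm_sq]
  push_cast
  rfl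

/-- `S = Σ_{l′}|u(p′+l′)|²Δ₀²/Δ²(p′+l′) = Δ₀²·𝒩/Δ²` on the torus leaves (`𝒩 = B5Strip145.Ncal`). [folklore] -/
theorem sSym_ofReal (hn : 1 ≤ n) (s : Fin d → ℝ) (hs : ∀ ν, |s ν| ≤ Real.pi)
    (hD : DeltaXi n 0 (ofRealVec s) ≠ 0) :
    sSym (fun l : Fin d → Fin n => uSym n l s) (fun l => ((DeltaXir n 0 (shiftr n l s) : ℝ) : ℂ))
        ((Delta1r 0 s : ℝ) : ℂ)
      = ((Delta1r 0 s : ℝ) : ℂ) ^ 2 * Ncal n (ofRealVec s) / DeltaXi n 0 (ofRealVec s) ^ 2 := by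
  rw [Ncal_eq_mul n _ hD]
  have h1 : ((Delta1r 0 s : ℝ) : ℂ) ^ 2 * (DeltaXi n 0 (ofRealVec s) ^ 2
        * ∑ k : Fin d → Fin n, U n k (ofRealVec s) / DeltaXi n 0 (shift n k (ofRealVec s)) ^ 2)
        / DeltaXi n 0 (ofRealVec s) ^ 2
      = ((Delta1r 0 s : ℝ) : ℂ) ^ 2
        * ∑ k : Fin d → Fin n, U n k (ofRealVec s) / DeltaXi n 0 (shift n k (ofRealVec s)) ^ 2 := by
    field_simp
  rw [h1, sSym, Finset.mul_sum]
  refine Finset.sum_congr rfl (fun k _ => ?_)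
  rw [U_ofReal_normSq n hn k s hs, DeltaXi_shift_ofReal]
  ring

omit [NeZero n] in
/-- `N = Σ_ν|∂¹_ν|²/(Δ₀²φ_ν) = (Σ_ν S₁(p′_ν)/φ_ν)/Δ₀²` on the torus leaves. [folklore] -/
theorem nSym_ofReal (s : Fin d → ℝ) :
    nSym (d1Sym s) (fun ν => ((phi162 n ν s : ℝ) : ℂ)) ((Delta1r 0 s : ℝ) : ℂ)
      = (∑ ν, S1 (ofRealVec s ν) / ((phi162 n ν s : ℝ) : ℂ)) / ((Delta1r 0 s : ℝ) : ℂ) ^ 2 := by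
  unfold nSym
  rw [Finset.sum_div]
  refine Finset.sum_congr rfl (fun ν _ => ?_)
  rw [S1_ofReal_normSq]
  ring

/-- `E = (Π_ν Y_ν)·Σ_ν S₁(p_ν)/Y_ν` wherever no `Y_ν` vanishes. [folklore] -/
theorem E66_eq_prod_mul_sum (p : Fin d → ℂ) (hY : ∀ ν, Yc n ν p ≠ 0) :
    E66 n p = (∏ ν, Yc n ν p) * ∑ ν, S1 (p ν) / Yc n ν p := by
  unfold E66
  rw [Finset.mul_sum]
  refine Finset.sum_congr rfl (fun ν _ => ?_)
  have hP : ∏ ν', Yc n ν' p = Yc n ν p * ∏ ν' ∈ univ.erase ν, Yc n ν' p :=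
    (Finset.mul_prod_erase _ _ (Finset.mem_univ ν)).symm
  rw [hP]
  field_simp [hY ν]

/-- `ρ_l = Δ(p′)/Δ(p′+l)` on the torus (all `l`, including `l = 0`). [folklore] -/
theorem rho_ofReal (hn : 1 ≤ n) (s : Fin d → ℝ) (hs : ∀ ν, |s ν| ≤ Real.pi) (ν₀ : Fin d) (hν₀ : s ν₀ ≠ 0)
    (k : Fin d → Fin n) :
    rho n k (ofRealVec s)
      = ((DeltaXir n 0 s : ℝ) : ℂ) / ((DeltaXir n 0 (shiftr n k s) : ℝ) : ℂ) := by
  unfold rho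
  by_cases hk : k = fun _ => 0
  · rw [if_pos hk, hk, shiftr_zero, div_self]
    exact_mod_cast (DeltaXir_pos n hn s hs ν₀ hν₀).ne'
  · rw [if_neg hk, DeltaXi_ofReal, DeltaXi_shift_ofReal]

/-- `T(l,l′) = Δ²(p′)/(Δ²(p′+l)Δ(p′+l′))` on the torus (all `l, l′`). [folklore] -/
theorem Tfac_ofReal (hn : 1 ≤ n) (s : Fin d → ℝ) (hs : ∀ ν, |s ν| ≤ Real.pi) (ν₀ : Fin d) (hν₀ : s ν₀ ≠ 0)
    (k k' : Fin d → Fin n) :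
    Tfac n k k' (ofRealVec s)
      = ((DeltaXir n 0 s : ℝ) : ℂ) ^ 2
          / (((DeltaXir n 0 (shiftr n k s) : ℝ) : ℂ) ^ 2 * ((DeltaXir n 0 (shiftr n k' s) : ℝ) : ℂ)) := by
  have hDr : ((DeltaXir n 0 s : ℝ) : ℂ) ≠ 0 := by exact_mod_cast (DeltaXir_pos n hn s hs ν₀ hν₀).ne'
  have hDk : ∀ l : Fin d → Fin n, ((DeltaXir n 0 (shiftr n l s) : ℝ) : ℂ) ≠ 0 := fun l => by
    exact_mod_cast ((Delta1r_pos s hs ν₀ hν₀).trans_le (Delta1r_le_DeltaXir_shift n hn l s)).ne'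
  unfold Tfac
  by_cases hk' : k' = fun _ => 0
  · rw [if_pos hk', hk', shiftr_zero, DeltaXi_ofReal, DeltaXi_shift_ofReal]
    have := hDk k
    field_simp
  · rw [if_neg hk', rho_ofReal n hn s hs ν₀ hν₀ k, DeltaXi_shift_ofReal]
    have := hDk k
    have := hDk k'
    field_simp

/-- the printed alias summand of (1.63) on the torus is `∂_μ(p′+l)ū(p′+l)·Δ₀²/Δ² · A_{l,l′}`. [folklore] -/
theorem summand163_ofReal (hn : 1 ≤ n) (s : Fin d → ℝ) (hs : ∀ ν, |s ν| ≤ Real.pi) (ν₀ : Fin d)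
    (hν₀ : s ν₀ ≠ 0) (μ : Fin d) (k k' : Fin d → Fin n) :
    summand163 (fun l : Fin d → Fin n => uSym n l s) (fun l => vSym n l s μ) (fun l => dSym n l s μ)
        (fun l => ((DeltaXir n 0 (shiftr n l s) : ℝ) : ℂ)) ((Delta1r 0 s : ℝ) : ℂ) k k'
      = dSym n k s μ * conj (uSym n k s) * (((Delta1r 0 s : ℝ) : ℂ) ^ 2 / ((DeltaXir n 0 s : ℝ) : ℂ) ^ 2)
          * Afac n μ k k' (ofRealVec s) := by
  have hDr : ((DeltaXir n 0 s : ℝ) : ℂ) ≠ 0 := by exact_mod_cast (DeltaXir_pos n hn s hs ν₀ hν₀).ne'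
  have hDk : ∀ l : Fin d → Fin n, ((DeltaXir n 0 (shiftr n l s) : ℝ) : ℂ) ≠ 0 := fun l => by
    exact_mod_cast ((Delta1r_pos s hs ν₀ hν₀).trans_le (Delta1r_le_DeltaXir_shift n hn l s)).ne'
  unfold summand163 Afac
  rw [U_ofReal_normSq n hn k' s hs, uFactor_ofReal_normSq n hn k' s μ (hs μ),
    uFactor_ofReal_normSq n hn k s μ (hs μ), Tfac_ofReal n hn s hs ν₀ hν₀ k k',
    Tfac_ofReal n hn s hs ν₀ hν₀ k' k]
  have := hDk k
  have := hDk k'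
  field_simp

/-- the head term of (1.63) on the torus is `headC · B̃_μ`. [folklore] -/
theorem head163_ofReal (hn : 1 ≤ n) (s : Fin d → ℝ) (hs : ∀ ν, |s ν| ≤ Real.pi) (ν₀ : Fin d)
    (hν₀ : s ν₀ ≠ 0) (μ : Fin d) (k : Fin d → Fin n) (Bt : Fin d → ℂ) :
    head163 (fun l : Fin d → Fin n => uSym n l s) (fun l => vSym n l s μ)
        (fun l => ((DeltaXir n 0 (shiftr n l s) : ℝ) : ℂ)) ((Delta1r 0 s : ℝ) : ℂ) Bt μ k
      = headC n μ k (ofRealVec s) * Bt μ := by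
  have hDr : ((DeltaXir n 0 s : ℝ) : ℂ) ≠ 0 := by exact_mod_cast (DeltaXir_pos n hn s hs ν₀ hν₀).ne'
  have hDk : ((DeltaXir n 0 (shiftr n k s) : ℝ) : ℂ) ≠ 0 := by
    exact_mod_cast ((Delta1r_pos s hs ν₀ hν₀).trans_le (Delta1r_le_DeltaXir_shift n hn k s)).ne'
  have hΔ0 : ((Delta1r 0 s : ℝ) : ℂ) ≠ 0 := by exact_mod_cast (Delta1r_pos s hs ν₀ hν₀).ne'
  have hφ : ((phi162 n μ s : ℝ) : ℂ) ≠ 0 := by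
    exact_mod_cast (B5Action165Lagrange.phi162_pos n hn μ s hs ν₀ hν₀).ne'
  unfold head163 headC
  rw [phiSym_ofReal, uCbar_ofReal, vCbar_ofReal, rho_ofReal n hn s hs ν₀ hν₀ k,
    Yc_ofReal n hn μ s hs ν₀ hν₀, map_mul]
  push_cast
  field_simp

/-- the coefficient of `B̃_λ` in the tail term of (1.63) on the torus is `tailC · gdir_λ`. [folklore] -/
theorem tail163_ofReal (hn : 1 ≤ n) (s : Fin d → ℝ) (hs : ∀ ν, |s ν| ≤ Real.pi) (ν₀ : Fin d)
    (hν₀ : s ν₀ ≠ 0) (μ lam : Fin d) (k : Fin d → Fin n) :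
    (∑ k' ∈ univ.erase k, summand163 (fun l : Fin d → Fin n => uSym n l s) (fun l => vSym n l s μ)
        (fun l => dSym n l s μ) (fun l => ((DeltaXir n 0 (shiftr n l s) : ℝ) : ℂ)) ((Delta1r 0 s : ℝ) : ℂ) k k')
      * (sSym (fun l : Fin d → Fin n => uSym n l s) (fun l => ((DeltaXir n 0 (shiftr n l s) : ℝ) : ℂ))
          ((Delta1r 0 s : ℝ) : ℂ))⁻¹
      * (1 / (((Delta1r 0 s : ℝ) : ℂ) * phiSym (fun l : Fin d → Fin n => uSym n l s) (fun l => vSym n l s μ)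
          (fun l => ((DeltaXir n 0 (shiftr n l s) : ℝ) : ℂ))))
      * (nSym (d1Sym s) (fun ν => ((phi162 n ν s : ℝ) : ℂ)) ((Delta1r 0 s : ℝ) : ℂ))⁻¹
      * (conj (d1Sym s lam) / (((Delta1r 0 s : ℝ) : ℂ) * ((phi162 n lam s : ℝ) : ℂ)))
      = tailC n μ k (ofRealVec s) * gdir n lam (ofRealVec s) := by
  -- positivity of the real data
  have hDrp : 0 < DeltaXir n 0 s := DeltaXir_pos n hn s hs ν₀ hν₀
  have hDr : ((DeltaXir n 0 s : ℝ) : ℂ) ≠ 0 := by exact_mod_cast hDrp.ne'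
  have hD : DeltaXi n 0 (ofRealVec s) = ((DeltaXir n 0 s : ℝ) : ℂ) := DeltaXi_ofReal n 0 s
  have hD0 : DeltaXi n 0 (ofRealVec s) ≠ 0 := by rw [hD]; exact hDr
  have hΔ0 : ((Delta1r 0 s : ℝ) : ℂ) ≠ 0 := by exact_mod_cast (Delta1r_pos s hs ν₀ hν₀).ne'
  have hφp : ∀ ν, 0 < phi162 n ν s := fun ν => B5Action165Lagrange.phi162_pos n hn ν s hs ν₀ hν₀
  have hφ : ∀ ν, ((phi162 n ν s : ℝ) : ℂ) ≠ 0 := fun ν => by exact_mod_cast (hφp ν).ne'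
  have hY : ∀ ν, Yc n ν (ofRealVec s) = ((DeltaXir n 0 s : ℝ) : ℂ) * ((phi162 n ν s : ℝ) : ℂ) := by
    intro ν; rw [Yc_ofReal n hn ν s hs ν₀ hν₀]; push_cast; ring
  have hYne : ∀ ν, Yc n ν (ofRealVec s) ≠ 0 := fun ν => by rw [hY ν]; exact mul_ne_zero hDr (hφ ν)
  have hPY : (∏ ν, Yc n ν (ofRealVec s)) ≠ 0 := Finset.prod_ne_zero_iff.mpr (fun ν _ => hYne ν)
  have hNc : Ncal n (ofRealVec s) ≠ 0 := by
    rw [Ncal_ofReal]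
    have := Ncalr_ge n hn s hs
    have h4 : 0 < (4 / Real.pi ^ 2 : ℝ) ^ d := by positivity
    exact_mod_cast (h4.trans_le this).ne'
  -- the direction sum `σ = Σ_ν S₁(p_ν)/φ_ν` is positive
  set σ : ℂ := ∑ ν, S1 (ofRealVec s ν) / ((phi162 n ν s : ℝ) : ℂ) with hσdef
  have hσ : σ ≠ 0 := by
    have hreal : σ = ((∑ ν, S1r (s ν) / phi162 n ν s : ℝ) : ℂ) := by
      rw [hσdef]; push_cast
      exact Finset.sum_congr rfl (fun ν _ => by rw [S1_ofRealVec])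
    rw [hreal]
    have hpos : 0 < ∑ ν, S1r (s ν) / phi162 n ν s := by
      have hterm : 0 < S1r (s ν₀) / phi162 n ν₀ s := div_pos (S1r_pos_of_ne (hs ν₀) hν₀) (hφp ν₀)
      have hle : S1r (s ν₀) / phi162 n ν₀ s ≤ ∑ ν, S1r (s ν) / phi162 n ν s :=
        Finset.single_le_sum (fun ν _ => div_nonneg (S1r_nonneg (s ν)) (hφp ν).le) (Finset.mem_univ ν₀)
      exact hterm.trans_le hle
    exact_mod_cast hpos.ne'
  -- `F = (ΠY)·σ/Δ²` from `E = Δ·F` and `E = ΠY·Σ S₁/Y`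
  have hF : F66 n (ofRealVec s) = (∏ ν, Yc n ν (ofRealVec s)) * σ / ((DeltaXir n 0 s : ℝ) : ℂ) ^ 2 := by
    have h1 := E66_eq_mul n (ofRealVec s)
    rw [E66_eq_prod_mul_sum n _ hYne, hD] at h1
    have h2 : ∑ ν, S1 (ofRealVec s ν) / Yc n ν (ofRealVec s) = σ / ((DeltaXir n 0 s : ℝ) : ℂ) := by
      rw [hσdef, Finset.sum_div]
      refine Finset.sum_congr rfl (fun ν _ => ?_)
      rw [hY ν]
      field_simp
    rw [h2] at h1
    have h3 : ((DeltaXir n 0 s : ℝ) : ℂ) * F66 n (ofRealVec s)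
        = (∏ ν, Yc n ν (ofRealVec s)) * σ / ((DeltaXir n 0 s : ℝ) : ℂ) := by
      rw [← h1]; ring
    calc F66 n (ofRealVec s)
        = ((DeltaXir n 0 s : ℝ) : ℂ) * F66 n (ofRealVec s) / ((DeltaXir n 0 s : ℝ) : ℂ) := by
          field_simp
      _ = (∏ ν, Yc n ν (ofRealVec s)) * σ / ((DeltaXir n 0 s : ℝ) : ℂ) / ((DeltaXir n 0 s : ℝ) : ℂ) := by
          rw [h3]
      _ = (∏ ν, Yc n ν (ofRealVec s)) * σ / ((DeltaXir n 0 s : ℝ) : ℂ) ^ 2 := by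
          rw [div_div, ← pow_two]
  -- rewrite both sides
  have hsum : ∑ k' ∈ univ.erase k, summand163 (fun l : Fin d → Fin n => uSym n l s) (fun l => vSym n l s μ)
        (fun l => dSym n l s μ) (fun l => ((DeltaXir n 0 (shiftr n l s) : ℝ) : ℂ)) ((Delta1r 0 s : ℝ) : ℂ) k k'
      = dSym n k s μ * conj (uSym n k s) * (((Delta1r 0 s : ℝ) : ℂ) ^ 2 / ((DeltaXir n 0 s : ℝ) : ℂ) ^ 2)
          * ∑ k' ∈ univ.erase k, Afac n μ k k' (ofRealVec s) := by
    rw [Finset.mul_sum]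
    exact Finset.sum_congr rfl (fun k' _ => summand163_ofReal n hn s hs ν₀ hν₀ μ k k')
  rw [hsum, sSym_ofReal n hn s hs hD0, phiSym_ofReal, nSym_ofReal, hD]
  unfold tailC gdir
  rw [dC_ofReal, uCbar_ofReal, expFacNeg_ofReal, hF, hY μ, hY lam, ← hσdef]
  field_simp

/-- **(1.63) ON THE TORUS = THE CONTINUED MULTIPLIER AT REAL MOMENTA.**  For `n ≥ 1`, `s ∈ [−π,π]^d ∖ {0}`:
the printed second expression of (1.63) (`B5Symbol163.second163` on the torus leaves of `B5Prop11Fiber`,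
`φ_μ = B5Bounds167Lattice.phi162`, `Δ₀ = Delta1r`) equals `Σ_λ h163 μ λ l (s) · B̃_λ`.
[cite: Balaban1984PropagatorsI, (1.63) p.28 (text of the formula only; the identity is ours)] [folklore] -/
theorem second163_eq_sum_h163 (hn : 1 ≤ n) (s : Fin d → ℝ) (hs : ∀ ν, |s ν| ≤ Real.pi) (ν₀ : Fin d)
    (hν₀ : s ν₀ ≠ 0) (μ : Fin d) (k : Fin d → Fin n) (Bt : Fin d → ℂ) :
    second163 (fun l : Fin d → Fin n => uSym n l s) (fun l => vSym n l s μ) (fun l => dSym n l s μ)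
        (fun l => ((DeltaXir n 0 (shiftr n l s) : ℝ) : ℂ)) ((Delta1r 0 s : ℝ) : ℂ) (d1Sym s)
        (fun ν => ((phi162 n ν s : ℝ) : ℂ)) Bt μ k
      = ∑ lam, h163 n μ lam k (ofRealVec s) * Bt lam := by
  have hrhs : ∑ lam, h163 n μ lam k (ofRealVec s) * Bt lam
      = headC n μ k (ofRealVec s) * Bt μ
        + ∑ lam, tailC n μ k (ofRealVec s) * gdir n lam (ofRealVec s) * Bt lam := by
    simp only [h163, add_mul, Finset.sum_add_distrib, ite_mul, zero_mul, Finset.sum_ite_eq',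
      Finset.mem_univ, if_true]
  rw [hrhs, second163, head163_ofReal n hn s hs ν₀ hν₀ μ k Bt, Finset.mul_sum]
  congr 1
  refine Finset.sum_congr rfl (fun lam _ => ?_)
  rw [← tail163_ofReal n hn s hs ν₀ hν₀ μ lam k, phiSym_ofReal]
  ring

end Real


/-! ## §4. The zero-free strip `|Im p′_ν| ≤ κ₁₆₃(d)` — `d`-only, uniform in `n ≥ 1` and in the alias index

Every denominator of `h163` is bounded away from zero on `Strip d κ`, `0 ≤ κ ≤ κ₁₆₃(d)`:
`‖F‖ ≥ ((4/π²)^d)^d/2` (`B5Symbol166Strip.F66_lower`, by name), `‖Y_λ‖ ≥ (4/π²)^{d+1}/2` (new, same engine: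
real lower bound + Cauchy-estimate Im-Lipschitz bound `B4StripCauchy.imLipschitz_of_fat` + `B4Strip.strip_lower_bound`),
`‖𝒩‖ ≥ (4/π²)^d/2` (`B5Strip145.Ncal_lower_of_ImLipschitz` + `B5Strip145Leaves.imLipschitzN_holds`, by name),
`‖Δ(p′+l)‖ ≥ 2` for `l ≠ 0` (`B4StripCauchy.norm_DeltaXi_shift_ge`, by name). -/

section Strip

/-- on real momenta `‖Y_λ‖ ≥ (4/π²)^{d+1}`: `Y_λ = c_λ + Δ·R̃_λ ≥ c_λ = U_0·u(0; s_λ) ≥ (4/π²)^d·(4/π²)`. [folklore] -/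
theorem norm_Yc_real_ge (n : ℕ) [NeZero n] (lam : Fin d) (s : Fin d → ℝ) (hs : ∀ μ, |s μ| ≤ Real.pi) :
    (4 / Real.pi ^ 2) ^ (d + 1) ≤ ‖Yc n lam (ofRealVec s)‖ := by
  have hn : 1 ≤ n := Nat.one_le_iff_ne_zero.mpr (NeZero.ne n)
  have hY : Yc n lam (ofRealVec s) = ((cfacr n lam s + DeltaXir n 0 s * Rtr n lam s : ℝ) : ℂ) := by
    unfold Yc; rw [cfac_ofReal, Rt_ofReal, DeltaXi_ofReal]; push_cast; ring
  rw [hY, Complex.norm_real, Real.norm_eq_abs]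
  have h1 : (4 / Real.pi ^ 2) ^ (d + 1) ≤ cfacr n lam s := by
    unfold cfacr
    rw [pow_succ]
    exact mul_le_mul (Ur_zero_ge n hn s hs) (uFactorr_zero_ge n hn (s lam) (hs lam)) (by positivity)
      (Ur_nonneg _ _ _)
  have h2 : 0 ≤ DeltaXir n 0 s * Rtr n lam s :=
    mul_nonneg (DeltaXir_nonneg n 0 le_rfl s) (Rtr_nonneg n lam s)
  exact h1.trans ((le_add_of_nonneg_right h2).trans (le_abs_self _))

/-- the `Y`-strip half-width `κ_Y(d) = min(r, c_Y·r/(2B²(d+1)))`, `c_Y = (4/π²)^{d+1}/2`, `r = rOf d`, `B = Bc d`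
(depends on `d` only). [folklore] -/
def kappaY (d : ℕ) : ℝ :=
  min (rOf d) ((4 / Real.pi ^ 2) ^ (d + 1) / 2 * rOf d / (2 * Bc d ^ 2 * ((d : ℝ) + 1)))

/-- `0 < κ_Y(d)`. [folklore] -/
theorem kappaY_pos (d : ℕ) : 0 < kappaY d := by
  unfold kappaY
  have h1 := rOf_pos d
  have h2 := Bc_pos d
  have h3 : (0 : ℝ) < (4 / Real.pi ^ 2) ^ (d + 1) / 2 := by positivity
  exact lt_min h1 (by positivity)

/-- `κ_Y(d) ≤ r`. [folklore] -/
theorem kappaY_le_rOf (d : ℕ) : kappaY d ≤ rOf d := min_le_left _ _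

/-- **`Y_λ` IS ZERO-FREE ON THE STRIP**: `‖Y_λ(p)‖ ≥ (4/π²)^{d+1}/2` on `Strip d κ`, `0 ≤ κ ≤ κ_Y(d)`, every `n ≥ 1`,
every direction `λ`. [folklore] -/
theorem Yc_lower (n : ℕ) [NeZero n] {κ : ℝ} (hκ0 : 0 ≤ κ) (hκ : κ ≤ kappaY d) (lam : Fin d) :
    ∀ p ∈ Strip d κ, (4 / Real.pi ^ 2) ^ (d + 1) / 2 ≤ ‖Yc n lam p‖ := by
  have hr := rOf_pos d
  have hκr : κ ≤ rOf d := hκ.trans (kappaY_le_rOf d)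
  have hB := Bc_pos d
  set c : ℝ := (4 / Real.pi ^ 2) ^ (d + 1) / 2 with hc
  have hc0 : 0 < c := by positivity
  have hdiff : ∀ q ∈ Fat d (rOf d), ∀ μ,
      DifferentiableAt ℂ (fun w => Yc n lam (Function.update q μ w)) (q μ) := by
    intro q hq μ
    have h := differentiableAt_Yc n (rOf_le d) (d_mul_rOf_sq_le d) hq lam
    rw [← Function.update_eq_self μ q] at h
    exact h.comp (q μ) (differentiableAt_update q μ (q μ))
  have hlip := imLipschitz_of_fat (fun p => Yc n lam p) hr hκ0 hκr hdiff
    (fun q hq => norm_Yc_le n (rOf_le d) (d_mul_rOf_sq_le d) hq lam)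
  refine strip_lower_bound (fun p => Yc n lam p) c (2 * Bc d ^ 2 / rOf d) κ ?_ hlip (by positivity) ?_
  · intro s hs
    rw [hc]
    have := norm_Yc_real_ge n lam s hs
    linarith
  · have hκ2 : κ ≤ c * rOf d / (2 * Bc d ^ 2 * ((d : ℝ) + 1)) := hκ.trans (min_le_right _ _)
    have hd : (0 : ℝ) ≤ d := Nat.cast_nonneg d
    calc 2 * Bc d ^ 2 / rOf d * (d * κ)
        ≤ 2 * Bc d ^ 2 / rOf d * (d * (c * rOf d / (2 * Bc d ^ 2 * ((d : ℝ) + 1)))) := by gcongr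
      _ = c * (d / ((d : ℝ) + 1)) := by field_simp
      _ ≤ c * 1 := by
          gcongr
          rw [div_le_one (by positivity)]
          linarith
      _ = c := mul_one c

/-- the `𝒩`-strip half-width `κ_N(d) = min(r, ((4/π²)^d/2)/(Λ_N·d + 1))` (depends on `d` only). [folklore] -/
def kappaN (d : ℕ) : ℝ := min (rOf d) ((4 / Real.pi ^ 2) ^ d / 2 / (LambdaN d * d + 1))

/-- `0 < κ_N(d)`. [folklore] -/
theorem kappaN_pos (d : ℕ) : 0 < kappaN d := by
  unfold kappaN
  have h1 := rOf_pos d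
  have h2 := LambdaN_nonneg d
  have h3 : (0 : ℝ) < (4 / Real.pi ^ 2) ^ d / 2 := by positivity
  exact lt_min h1 (by positivity)

/-- `κ_N(d) ≤ r`. [folklore] -/
theorem kappaN_le_rOf (d : ℕ) : kappaN d ≤ rOf d := min_le_left _ _

/-- **`𝒩` IS ZERO-FREE ON THE STRIP** with an explicit `d`-only half-width: `‖𝒩(p)‖ ≥ (4/π²)^d/2` on `Strip d κ`,
`0 ≤ κ ≤ κ_N(d)`, every `n ≥ 1` (the kernel form `B5Strip145.Ncal_lower_of_ImLipschitz` with
`B5Strip145Leaves.imLipschitzN_holds`). [folklore] -/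
theorem Ncal_lower (n : ℕ) [NeZero n] {κ : ℝ} (hκ0 : 0 ≤ κ) (hκ : κ ≤ kappaN d) :
    ∀ p ∈ Strip d κ, (4 / Real.pi ^ 2) ^ d / 2 ≤ ‖Ncal n p‖ := by
  have hn : 1 ≤ n := Nat.one_le_iff_ne_zero.mpr (NeZero.ne n)
  have hκr : κ ≤ rOf d := hκ.trans (kappaN_le_rOf d)
  refine Ncal_lower_of_ImLipschitz n hn κ (LambdaN d) (LambdaN_nonneg d) (imLipschitzN_holds n hκ0 hκr) ?_
  exact smallness_aux (LambdaN d) _ κ d (LambdaN_nonneg d) (by positivity) (hκ.trans (min_le_right _ _))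

/-- **THE STRIP HALF-WIDTH OF (1.63)**: `κ₁₆₃(d) = min(κ₁₆₆(d), κ_Y(d), κ_N(d))` — depends on `d` only
(uniform in the lattice parameter `n = L^k` and in the alias index). [folklore] -/
def kappa163 (d : ℕ) : ℝ := min (kappa166 d) (min (kappaY d) (kappaN d))

/-- `0 < κ₁₆₃(d)`. [folklore] -/
theorem kappa163_pos (d : ℕ) : 0 < kappa163 d :=
  lt_min (kappa166_pos d) (lt_min (kappaY_pos d) (kappaN_pos d))

/-- `κ₁₆₃ ≤ κ₁₆₆`. [folklore] -/
theorem kappa163_le_kappa166 (d : ℕ) : kappa163 d ≤ kappa166 d := min_le_left _ _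

/-- `κ₁₆₃ ≤ κ_Y`. [folklore] -/
theorem kappa163_le_kappaY (d : ℕ) : kappa163 d ≤ kappaY d := (min_le_right _ _).trans (min_le_left _ _)

/-- `κ₁₆₃ ≤ κ_N`. [folklore] -/
theorem kappa163_le_kappaN (d : ℕ) : kappa163 d ≤ kappaN d := (min_le_right _ _).trans (min_le_right _ _)

/-- `κ₁₆₃ ≤ r(d)`. [folklore] -/
theorem kappa163_le_rOf (d : ℕ) : kappa163 d ≤ rOf d := (kappa163_le_kappa166 d).trans (kappa166_le_rOf d)

/-- **THE ZERO-FREE STRIP (quantitative).**  On `Strip d κ`, `0 ≤ κ ≤ κ₁₆₃(d)`, for every `n ≥ 1`: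
`‖F‖ ≥ ((4/π²)^d)^d/2`, `‖𝒩‖ ≥ (4/π²)^d/2`, `‖Y_λ‖ ≥ (4/π²)^{d+1}/2` (all `λ`), `‖Δ(p′+l)‖ ≥ 2` (all `l ≠ 0`). [folklore] -/
theorem denominators_lower (n : ℕ) [NeZero n] {κ : ℝ} (hκ0 : 0 ≤ κ) (hκ : κ ≤ kappa163 d)
    {p : Fin d → ℂ} (hp : p ∈ Strip d κ) :
    ((4 / Real.pi ^ 2) ^ d) ^ d / 2 ≤ ‖F66 n p‖ ∧ (4 / Real.pi ^ 2) ^ d / 2 ≤ ‖Ncal n p‖ ∧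
      (∀ lam, (4 / Real.pi ^ 2) ^ (d + 1) / 2 ≤ ‖Yc n lam p‖) ∧
      ∀ k : Fin d → Fin n, k ≠ (fun _ => 0) → 2 ≤ ‖DeltaXi n 0 (shift n k p)‖ := by
  refine ⟨F66_lower n hκ0 (hκ.trans (kappa163_le_kappa166 d)) p hp,
    Ncal_lower n hκ0 (hκ.trans (kappa163_le_kappaN d)) p hp,
    fun lam => Yc_lower n hκ0 (hκ.trans (kappa163_le_kappaY d)) lam p hp, fun k hk => ?_⟩
  exact norm_DeltaXi_shift_ge n 0 le_rfl (rOf_le d) (d_mul_rOf_sq_le d)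
    (strip_subset_fat (rOf_pos d).le (hκ.trans (kappa163_le_rOf d)) hp) k hk

/-- **THE ZERO-FREE STRIP.**  On `Strip d κ`, `0 ≤ κ ≤ κ₁₆₃(d)`, every denominator of `h163` is nonzero, for
every `n ≥ 1` and every alias index. [folklore] -/
theorem denominators_ne_zero (n : ℕ) [NeZero n] {κ : ℝ} (hκ0 : 0 ≤ κ) (hκ : κ ≤ kappa163 d)
    {p : Fin d → ℂ} (hp : p ∈ Strip d κ) :
    F66 n p ≠ 0 ∧ Ncal n p ≠ 0 ∧ (∀ lam, Yc n lam p ≠ 0) ∧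
      ∀ k : Fin d → Fin n, k ≠ (fun _ => 0) → DeltaXi n 0 (shift n k p) ≠ 0 := by
  obtain ⟨hF, hN, hY, hD⟩ := denominators_lower n hκ0 hκ hp
  have c1 : (0 : ℝ) < ((4 / Real.pi ^ 2) ^ d) ^ d / 2 := by positivity
  have c2 : (0 : ℝ) < (4 / Real.pi ^ 2) ^ d / 2 := by positivity
  have c3 : (0 : ℝ) < (4 / Real.pi ^ 2) ^ (d + 1) / 2 := by positivity
  refine ⟨fun h => ?_, fun h => ?_, fun lam h => ?_, fun k hk h => ?_⟩
  · rw [h, norm_zero] at hF; linarith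
  · rw [h, norm_zero] at hN; linarith
  · have := hY lam; rw [h, norm_zero] at this; linarith
  · have := hD k hk; rw [h, norm_zero] at this; linarith

end Strip

/-! ## §5. Holomorphy of the continued multiplier on the zero-free strip -/

section Holo

variable (n : ℕ) [NeZero n]

omit [NeZero n] in
/-- `p ↦ shift n k p μ / n · I` is entire (affine). [folklore] -/
theorem differentiable_shiftPhase (k : Fin d → Fin n) (μ : Fin d) :
    Differentiable ℂ (fun p : Fin d → ℂ => shift n k p μ / n * I) := by
  intro q
  have h1 : DifferentiableAt ℂ (fun p : Fin d → ℂ => p μ + 2 * Real.pi * ((k μ : ℕ) : ℂ)) q :=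
    (differentiableAt_apply (𝕜 := ℂ) μ q).add_const _
  have h3 : DifferentiableAt ℂ
      (fun p : Fin d → ℂ => (p μ + 2 * Real.pi * ((k μ : ℕ) : ℂ)) * (n : ℂ)⁻¹ * I) q :=
    (h1.mul_const _).mul_const I
  unfold shift
  simp only [div_eq_mul_inv]
  exact h3

omit [NeZero n] in
/-- `dC` is entire. [folklore] -/
theorem differentiable_dC (k : Fin d → Fin n) (μ : Fin d) :
    Differentiable ℂ (fun p : Fin d → ℂ => dC n k p μ) := by
  unfold dC
  exact ((differentiable_shiftPhase n k μ).cexp.sub_const 1).const_mul _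

omit [NeZero n] in
/-- `vCbar` is entire. [folklore] -/
theorem differentiable_vCbar (k : Fin d → Fin n) (μ : Fin d) :
    Differentiable ℂ (fun p : Fin d → ℂ => vCbar n k p μ) := by
  intro q
  have hs : DifferentiableAt ℂ
      (fun p : Fin d → ℂ => (∑ j : Fin n, Complex.exp (-(shift n k p μ / n * I * ((j : ℕ) : ℂ)))) * (n : ℂ)⁻¹) q :=
    (DifferentiableAt.fun_sum (fun j _ => (((differentiable_shiftPhase n k μ) q).mul_const _).neg.cexp)).mul_const _
  have he : (fun p : Fin d → ℂ => vCbar n k p μ)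
      = fun p => (∑ j : Fin n, Complex.exp (-(shift n k p μ / n * I * ((j : ℕ) : ℂ)))) * (n : ℂ)⁻¹ := by
    funext p
    rw [vCbar, div_eq_mul_inv]
  rw [he]
  exact hs

omit [NeZero n] in
/-- `uCbar` is entire. [folklore] -/
theorem differentiable_uCbar (k : Fin d → Fin n) :
    Differentiable ℂ (fun p : Fin d → ℂ => uCbar n k p) := by
  intro q
  unfold uCbar
  exact dAt_finset_prod _ _ q (fun μ _ => differentiable_vCbar n k μ q)

/-- `p ↦ u_n(k_μ; p_μ)` is holomorphic at fat points (`r ≤ 1/4`). [folklore] -/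
theorem differentiableAt_uFactor_apply {r : ℝ} (hr : r ≤ 1 / 4) {q : Fin d → ℂ} (hq : q ∈ Fat d r)
    (k : Fin d → Fin n) (μ : Fin d) :
    DifferentiableAt ℂ (fun p : Fin d → ℂ => uFactor n (k μ : ℕ) (p μ)) q := by
  have hn : 1 ≤ n := Nat.one_le_iff_ne_zero.mpr (NeZero.ne n)
  have hπ := Real.pi_gt_three
  have hF : DifferentiableAt ℂ (uFactor n (k μ : ℕ)) (q μ) := by
    by_cases hk : (k μ : ℕ) = 0
    · rw [hk]
      exact differentiableAt_uFactor_zero n hn (by linarith [(hq μ).1, hr])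
    · exact differentiableAt_uFactor_ne n _ hk
        (Sxi_shift_ne_zero n _ (Nat.one_le_iff_ne_zero.mpr hk) (k μ).isLt hr (hq μ).1)
  exact hF.comp q (differentiableAt_apply (𝕜 := ℂ) μ q)

/-- `ρ_l` is holomorphic at fat points (`r ≤ 1/4`, `d r² ≤ 1/16`). [folklore] -/
theorem differentiableAt_rho {r : ℝ} (hr : r ≤ 1 / 4) (hdr : (d : ℝ) * r ^ 2 ≤ 1 / 16)
    {q : Fin d → ℂ} (hq : q ∈ Fat d r) (k : Fin d → Fin n) :
    DifferentiableAt ℂ (fun p : Fin d → ℂ => rho n k p) q := by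
  unfold rho
  by_cases hk : k = fun _ => 0
  · simp only [hk, if_true]
    exact differentiableAt_const _
  · simp only [hk, if_false]
    exact dAt_div (differentiableAt_DeltaXi n 0 q) (differentiableAt_DeltaXi_shift n 0 k q)
      (fun h => by
        have := norm_DeltaXi_shift_ge n 0 le_rfl hr hdr hq k hk
        rw [h, norm_zero] at this
        linarith)

/-- `T(l,l′)` is holomorphic at fat points whenever `(l,l′) ≠ (0,0)`. [folklore] -/
theorem differentiableAt_Tfac {r : ℝ} (hr : r ≤ 1 / 4) (hdr : (d : ℝ) * r ^ 2 ≤ 1 / 16)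
    {q : Fin d → ℂ} (hq : q ∈ Fat d r) (k k' : Fin d → Fin n) (hkk : k ≠ (fun _ => 0) ∨ k' ≠ (fun _ => 0)) :
    DifferentiableAt ℂ (fun p : Fin d → ℂ => Tfac n k k' p) q := by
  have hD : ∀ l : Fin d → Fin n, l ≠ (fun _ => 0) → DeltaXi n 0 (shift n l q) ≠ 0 := fun l hl h => by
    have := norm_DeltaXi_shift_ge n 0 le_rfl hr hdr hq l hl
    rw [h, norm_zero] at this
    linarith
  unfold Tfac
  by_cases hk' : k' = fun _ => 0
  · simp only [hk', if_true]
    have hk : k ≠ fun _ => 0 := hkk.resolve_right (fun h => h hk')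
    exact dAt_div (differentiableAt_DeltaXi n 0 q) ((differentiableAt_DeltaXi_shift n 0 k q).pow 2)
      (pow_ne_zero 2 (hD k hk))
  · simp only [hk', if_false]
    exact dAt_div ((differentiableAt_rho n hr hdr hq k).pow 2) (differentiableAt_DeltaXi_shift n 0 k' q)
      (hD k' hk')

/-- `A_{l,l′}` is holomorphic at fat points for `l′ ≠ l`. [folklore] -/
theorem differentiableAt_Afac {r : ℝ} (hr : r ≤ 1 / 4) (hdr : (d : ℝ) * r ^ 2 ≤ 1 / 16)
    {q : Fin d → ℂ} (hq : q ∈ Fat d r) (μ : Fin d) (k k' : Fin d → Fin n) (hkk : k' ≠ k) :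
    DifferentiableAt ℂ (fun p : Fin d → ℂ => Afac n μ k k' p) q := by
  have h1 : k ≠ (fun _ => 0) ∨ k' ≠ (fun _ => 0) := by
    by_cases hk : k = fun _ => 0
    · exact Or.inr (fun h => hkk (h.trans hk.symm))
    · exact Or.inl hk
  have h2 : k' ≠ (fun _ => 0) ∨ k ≠ (fun _ => 0) := h1.symm
  unfold Afac
  exact (differentiableAt_U n hr hq k').mul
    (((differentiableAt_uFactor_apply n hr hq k' μ).mul (differentiableAt_Tfac n hr hdr hq k k' h1)).sub
      ((differentiableAt_uFactor_apply n hr hq k μ).mul (differentiableAt_Tfac n hr hdr hq k' k h2)))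

/-- **HOLOMORPHY**: on the zero-free strip `Strip d κ`, `0 ≤ κ ≤ κ₁₆₃(d)`, the continued (1.63) multiplier
`p′ ↦ h163 μ λ l (p′)` is holomorphic (jointly in `p′ ∈ ℂ^d`), for every `n ≥ 1`, `μ`, `λ` and alias index `l`. [folklore] -/
theorem differentiableAt_h163 {κ : ℝ} (hκ0 : 0 ≤ κ) (hκ : κ ≤ kappa163 d) {p : Fin d → ℂ}
    (hp : p ∈ Strip d κ) (μ lam : Fin d) (k : Fin d → Fin n) :
    DifferentiableAt ℂ (fun q : Fin d → ℂ => h163 n μ lam k q) p := by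
  have hr := rOf_le d
  have hdr := d_mul_rOf_sq_le d
  have hq : p ∈ Fat d (rOf d) := strip_subset_fat (rOf_pos d).le (hκ.trans (kappa163_le_rOf d)) hp
  obtain ⟨hF, hN, hY, _⟩ := denominators_ne_zero n hκ0 hκ hp
  have hYd : ∀ ν, DifferentiableAt ℂ (fun q : Fin d → ℂ => Yc n ν q) p :=
    fun ν => differentiableAt_Yc n hr hdr hq ν
  have hhead : DifferentiableAt ℂ (fun q : Fin d → ℂ => headC n μ k q) p := by
    unfold headC
    exact dAt_div ((((differentiable_uCbar n k) p).mul ((differentiable_vCbar n k μ) p)).mul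
      (differentiableAt_rho n hr hdr hq k)) (hYd μ) (hY μ)
  have htail : DifferentiableAt ℂ (fun q : Fin d → ℂ => tailC n μ k q) p := by
    unfold tailC
    refine (dAt_div ?_ (differentiableAt_Ncal n hr hdr hq) hN).mul
      (dAt_div (dAt_finset_prod _ _ p (fun ν _ => hYd ν)) ((hYd μ).mul (differentiableAt_F66 n hr hdr hq))
        (mul_ne_zero (hY μ) hF))
    refine (((differentiable_dC n k μ) p).mul ((differentiable_uCbar n k) p)).mul ?_
    exact DifferentiableAt.fun_sum (fun k' hk' => differentiableAt_Afac n hr hdr hq μ k k'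
      (Finset.ne_of_mem_erase hk'))
  have hgdir : DifferentiableAt ℂ (fun q : Fin d → ℂ => gdir n lam q) p := by
    unfold gdir
    exact dAt_div ((differentiable_expFacNeg lam) p) (hYd lam) (hY lam)
  unfold h163
  by_cases hlm : lam = μ
  · simp only [hlm, if_true]
    exact hhead.add (htail.mul (by simpa [hlm] using hgdir))
  · simp only [hlm, if_false, zero_add]
    exact htail.mul hgdir

end Holo


/-! ## §6. Uniform bounds on the zero-free strip (uniform in `n ≥ 1` and in the alias index)

Crude, explicit, `d`-only constants.  The alias DECAY in `l` (needed to sum the kernel over aliases uniformly in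
`n`) is NOT proved here — see the HONEST SCOPE paragraph of the header. -/

section Bounds

variable (n : ℕ) [NeZero n]

/-- quotient bound: `‖a/b‖ ≤ A/c` from `‖a‖ ≤ A`, `0 < c ≤ ‖b‖`. [folklore] -/
theorem norm_div_le_of {a b : ℂ} {A c : ℝ} (hA : ‖a‖ ≤ A) (hc : 0 < c) (hb : c ≤ ‖b‖) :
    ‖a / b‖ ≤ A / c := by
  rw [norm_div, div_le_div_iff₀ (lt_of_lt_of_le hc hb) hc]
  exact mul_le_mul hA hb hc.le ((norm_nonneg _).trans hA)

omit [NeZero n] in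
/-- the imaginary part of the shifted coordinate is that of the coordinate. [folklore] -/
theorem shift_im (k : Fin d → Fin n) (q : Fin d → ℂ) (μ : Fin d) : (shift n k q μ).im = (q μ).im := by
  simp [shift]

/-- a phase factor `e^{−ijη(p_μ+l_μ)}`, `0 ≤ j ≤ n`, has modulus `≤ e^{|Im p_μ|} ≤ 2` on the fat region. [folklore] -/
theorem norm_exp_phase_le {r : ℝ} (hr : r ≤ 1 / 4) {q : Fin d → ℂ} (hq : q ∈ Fat d r)
    (k : Fin d → Fin n) (μ : Fin d) {t : ℝ} (ht0 : -1 ≤ t) (ht1 : t ≤ 1) :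
    ‖Complex.exp (-(shift n k q μ / n * I * (t * n : ℝ)))‖ ≤ 2 := by
  have hn : (0 : ℝ) < n := Nat.cast_pos.mpr (Nat.pos_of_ne_zero (NeZero.ne n))
  have him := (hq μ).2
  rw [Complex.norm_exp]
  have exp_half_le_two : Real.exp (1 / 2) ≤ 2 := by
    have h1 : Real.exp (1 / 2) ^ 2 = Real.exp 1 := by
      rw [← Real.exp_nat_mul]; norm_num
    nlinarith [Real.exp_one_lt_d9, Real.exp_pos (1 / 2 : ℝ)]
  refine le_trans (Real.exp_le_exp.mpr ?_) exp_half_le_two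
  have hre : (-(shift n k q μ / n * I * ((t * n : ℝ) : ℂ))).re = (q μ).im * t := by
    have : (-(shift n k q μ / n * I * ((t * n : ℝ) : ℂ))).re = (shift n k q μ).im / n * (t * n) := by
      simp [Complex.mul_re, Complex.mul_im]
    rw [this, shift_im]
    field_simp
  rw [hre]
  have h1 : (q μ).im * t ≤ |(q μ).im| * 1 := by
    calc (q μ).im * t ≤ |(q μ).im * t| := le_abs_self _
      _ = |(q μ).im| * |t| := abs_mul _ _
      _ ≤ |(q μ).im| * 1 := by gcongr; exact abs_le.mpr ⟨ht0, ht1⟩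
  linarith

/-- `‖v̄C_μ(p′+l)‖ ≤ 2` on the fat region (`r ≤ 1/4`), all `n`, all `l`. [folklore] -/
theorem norm_vCbar_le {r : ℝ} (hr : r ≤ 1 / 4) {q : Fin d → ℂ} (hq : q ∈ Fat d r)
    (k : Fin d → Fin n) (μ : Fin d) : ‖vCbar n k q μ‖ ≤ 2 := by
  have hn0 : (n : ℝ) ≠ 0 := Nat.cast_ne_zero.mpr (NeZero.ne n)
  have hn : (0 : ℝ) < n := Nat.cast_pos.mpr (Nat.pos_of_ne_zero (NeZero.ne n))
  unfold vCbar
  rw [norm_div, Complex.norm_natCast, div_le_iff₀ hn]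
  have hterm : ∀ j : Fin n, ‖Complex.exp (-(shift n k q μ / n * I * ((j : ℕ) : ℂ)))‖ ≤ 2 := by
    intro j
    have hj : ((j : ℕ) : ℝ) < n := by exact_mod_cast j.isLt
    have ht1 : ((j : ℕ) : ℝ) / n ≤ 1 := by rw [div_le_one hn]; exact hj.le
    have ht0 : -1 ≤ ((j : ℕ) : ℝ) / n := by
      have : 0 ≤ ((j : ℕ) : ℝ) / n := by positivity
      linarith
    have h := norm_exp_phase_le n hr hq k μ ht0 ht1
    have hcast : (((((j : ℕ) : ℝ) / n * n : ℝ)) : ℂ) = ((j : ℕ) : ℂ) := by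
      rw [div_mul_cancel₀ _ hn0]; push_cast; rfl
    rwa [hcast] at h
  calc ‖∑ j : Fin n, Complex.exp (-(shift n k q μ / n * I * ((j : ℕ) : ℂ)))‖
      ≤ ∑ j : Fin n, ‖Complex.exp (-(shift n k q μ / n * I * ((j : ℕ) : ℂ)))‖ := norm_sum_le _ _
    _ ≤ ∑ _j : Fin n, (2 : ℝ) := Finset.sum_le_sum (fun j _ => hterm j)
    _ = 2 * n := by simp [mul_comm]

/-- `‖∂_μ(p′+l)·v̄C_μ(p′+l)‖ ≤ 4` on the fat region, all `n`, all `l` (although `‖∂_μ(p′+l)‖ ∼ n`). [folklore] -/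
theorem norm_dC_mul_vCbar_le {r : ℝ} (hr : r ≤ 1 / 4) {q : Fin d → ℂ} (hq : q ∈ Fat d r)
    (k : Fin d → Fin n) (μ : Fin d) : ‖dC n k q μ * vCbar n k q μ‖ ≤ 4 := by
  have hn0 : (n : ℝ) ≠ 0 := Nat.cast_ne_zero.mpr (NeZero.ne n)
  have hn1 : (1 : ℝ) ≤ n := by exact_mod_cast Nat.one_le_iff_ne_zero.mpr (NeZero.ne n)
  rw [dC_mul_vCbar]
  have h1 : ‖Complex.exp (shift n k q μ / n * I)‖ ≤ 2 := by
    have ht0 : (-1 : ℝ) ≤ -(1 / n) := by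
      have : (1 : ℝ) / n ≤ 1 := by rw [div_le_one (by positivity)]; exact hn1
      linarith
    have ht1 : -(1 / (n : ℝ)) ≤ 1 := by
      have : (0 : ℝ) ≤ 1 / n := by positivity
      linarith
    have h := norm_exp_phase_le n hr hq k μ ht0 ht1
    have hcast : -(shift n k q μ / n * I * ((-(1 / (n : ℝ)) * n : ℝ) : ℂ)) = shift n k q μ / n * I := by
      rw [show (-(1 / (n : ℝ)) * n : ℝ) = -1 by field_simp]
      push_cast
      ring
    rwa [hcast] at h
  have h2 : ‖Complex.exp (-(shift n k q μ / n * I * ((n : ℂ) - 1)))‖ ≤ 2 := by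
    have ht0 : (-1 : ℝ) ≤ 1 - 1 / n := by
      have : (1 : ℝ) / n ≤ 1 := by rw [div_le_one (by positivity)]; exact hn1
      linarith
    have ht1 : 1 - 1 / (n : ℝ) ≤ 1 := by
      have : (0 : ℝ) ≤ 1 / n := by positivity
      linarith
    have h := norm_exp_phase_le n hr hq k μ ht0 ht1
    have hcast : (((1 - 1 / (n : ℝ)) * n : ℝ) : ℂ) = (n : ℂ) - 1 := by
      rw [show ((1 - 1 / (n : ℝ)) * n : ℝ) = n - 1 by field_simp]
      push_cast
      ring
    rwa [hcast] at h
  calc ‖Complex.exp (shift n k q μ / n * I) - Complex.exp (-(shift n k q μ / n * I * ((n : ℂ) - 1)))‖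
      ≤ ‖Complex.exp (shift n k q μ / n * I)‖ + ‖Complex.exp (-(shift n k q μ / n * I * ((n : ℂ) - 1)))‖ :=
        norm_sub_le _ _
    _ ≤ 2 + 2 := add_le_add h1 h2
    _ = 4 := by norm_num

/-- `‖ūC(p′+l)‖ ≤ 2^d` on the fat region. [folklore] -/
theorem norm_uCbar_le {r : ℝ} (hr : r ≤ 1 / 4) {q : Fin d → ℂ} (hq : q ∈ Fat d r) (k : Fin d → Fin n) :
    ‖uCbar n k q‖ ≤ 2 ^ d := by
  unfold uCbar
  exact norm_prod_le_pow _ _ (by norm_num) (by simp) (fun μ _ => norm_vCbar_le n hr hq k μ)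

/-- `‖∂_μ(p′+l) ūC(p′+l)‖ ≤ 4·2^d` on the fat region, all `n`, all `l`. [folklore] -/
theorem norm_dC_mul_uCbar_le {r : ℝ} (hr : r ≤ 1 / 4) {q : Fin d → ℂ} (hq : q ∈ Fat d r)
    (k : Fin d → Fin n) (μ : Fin d) : ‖dC n k q μ * uCbar n k q‖ ≤ 4 * 2 ^ d := by
  have hP : uCbar n k q = vCbar n k q μ * ∏ ν ∈ univ.erase μ, vCbar n k q ν :=
    (Finset.mul_prod_erase _ _ (Finset.mem_univ μ)).symm
  rw [hP, ← mul_assoc, norm_mul]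
  have h2 : ‖∏ ν ∈ univ.erase μ, vCbar n k q ν‖ ≤ 2 ^ d :=
    norm_prod_le_pow _ _ (by norm_num) ((Finset.card_le_univ _).trans (by simp))
      (fun ν _ => norm_vCbar_le n hr hq k ν)
  exact mul_le_mul (norm_dC_mul_vCbar_le n hr hq k μ) h2 (norm_nonneg _) (by norm_num)

/-- `‖ρ_l‖ ≤ 8d + 1` on the fat region (`‖Δ(p′)‖ ≤ 16d`, `‖Δ(p′+l)‖ ≥ 2` for `l ≠ 0`). [folklore] -/
theorem norm_rho_le {r : ℝ} (hr : r ≤ 1 / 4) (hdr : (d : ℝ) * r ^ 2 ≤ 1 / 16) {q : Fin d → ℂ}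
    (hq : q ∈ Fat d r) (k : Fin d → Fin n) : ‖rho n k q‖ ≤ 8 * d + 1 := by
  have hd : (0 : ℝ) ≤ d := Nat.cast_nonneg d
  unfold rho
  by_cases hk : k = fun _ => 0
  · simp only [hk, if_true, norm_one]
    linarith
  · simp only [hk, if_false]
    have h := norm_div_le_of (norm_DeltaXi0_le n hr hq) two_pos (norm_DeltaXi_shift_ge n 0 le_rfl hr hdr hq k hk)
    linarith

/-- the constant `C_T(d) = 4d + (8d+1)²/2` bounding `T(l,l′)`. [folklore] -/
def CT163 (d : ℕ) : ℝ := 4 * d + (8 * d + 1) ^ 2 / 2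

/-- `0 ≤ C_T(d)`. [folklore] -/
theorem CT163_nonneg (d : ℕ) : 0 ≤ CT163 d := by unfold CT163; positivity

/-- `‖T(l,l′)‖ ≤ C_T(d)` on the fat region for `(l,l′) ≠ (0,0)`. [folklore] -/
theorem norm_Tfac_le {r : ℝ} (hr : r ≤ 1 / 4) (hdr : (d : ℝ) * r ^ 2 ≤ 1 / 16) {q : Fin d → ℂ}
    (hq : q ∈ Fat d r) (k k' : Fin d → Fin n) (hkk : k ≠ (fun _ => 0) ∨ k' ≠ (fun _ => 0)) :
    ‖Tfac n k k' q‖ ≤ CT163 d := by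
  have hd : (0 : ℝ) ≤ d := Nat.cast_nonneg d
  unfold Tfac CT163
  by_cases hk' : k' = fun _ => 0
  · simp only [hk', if_true]
    have hk : k ≠ fun _ => 0 := hkk.resolve_right (fun h => h hk')
    have hlow : (4 : ℝ) ≤ ‖DeltaXi n 0 (shift n k q) ^ 2‖ := by
      rw [norm_pow]
      nlinarith [norm_DeltaXi_shift_ge n 0 le_rfl hr hdr hq k hk, norm_nonneg (DeltaXi n 0 (shift n k q))]
    have h := norm_div_le_of (norm_DeltaXi0_le n hr hq) (by norm_num) hlow
    have h2 : (0 : ℝ) ≤ (8 * d + 1) ^ 2 / 2 := by positivity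
    linarith
  · simp only [hk', if_false]
    have hρ := norm_rho_le n hr hdr hq k
    have hρ2 : ‖rho n k q ^ 2‖ ≤ (8 * d + 1) ^ 2 := by
      rw [norm_pow]
      exact pow_le_pow_left₀ (norm_nonneg _) hρ 2
    have h := norm_div_le_of hρ2 two_pos (norm_DeltaXi_shift_ge n 0 le_rfl hr hdr hq k' hk')
    linarith

/-- `‖u_n(l_μ; p_μ)‖ ≤ 132` on the fat region. [folklore] -/
theorem norm_uFactor_apply_le {r : ℝ} (hr : r ≤ 1 / 4) {q : Fin d → ℂ} (hq : q ∈ Fat d r)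
    (k : Fin d → Fin n) (μ : Fin d) : ‖uFactor n (k μ : ℕ) (q μ)‖ ≤ 132 :=
  norm_uFactor_le_132 n (k μ) hr (hq μ).1 (hq μ).2

/-- `‖A_{l,l′}‖ ≤ ‖U_{l′}‖·264·C_T(d)` on the fat region, `l′ ≠ l`. [folklore] -/
theorem norm_Afac_le {r : ℝ} (hr : r ≤ 1 / 4) (hdr : (d : ℝ) * r ^ 2 ≤ 1 / 16) {q : Fin d → ℂ}
    (hq : q ∈ Fat d r) (μ : Fin d) (k k' : Fin d → Fin n) (hkk : k' ≠ k) :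
    ‖Afac n μ k k' q‖ ≤ ‖U n k' q‖ * (264 * CT163 d) := by
  have h1 : k ≠ (fun _ => 0) ∨ k' ≠ (fun _ => 0) := by
    by_cases hk : k = fun _ => 0
    · exact Or.inr (fun h => hkk (h.trans hk.symm))
    · exact Or.inl hk
  have hT1 := norm_Tfac_le n hr hdr hq k k' h1
  have hT2 := norm_Tfac_le n hr hdr hq k' k h1.symm
  have hu1 := norm_uFactor_apply_le n hr hq k' μ
  have hu2 := norm_uFactor_apply_le n hr hq k μ
  have hC := CT163_nonneg d
  unfold Afac
  rw [norm_mul]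
  refine mul_le_mul_of_nonneg_left ?_ (norm_nonneg _)
  calc ‖uFactor n (k' μ : ℕ) (q μ) * Tfac n k k' q - uFactor n (k μ : ℕ) (q μ) * Tfac n k' k q‖
      ≤ ‖uFactor n (k' μ : ℕ) (q μ) * Tfac n k k' q‖ + ‖uFactor n (k μ : ℕ) (q μ) * Tfac n k' k q‖ :=
        norm_sub_le _ _
    _ ≤ 132 * CT163 d + 132 * CT163 d := by
        rw [norm_mul, norm_mul]
        exact add_le_add (mul_le_mul hu1 hT1 (norm_nonneg _) (by norm_num))
          (mul_le_mul hu2 hT2 (norm_nonneg _) (by norm_num))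
    _ = 264 * CT163 d := by ring

/-- `‖Σ_{l′≠l} A_{l,l′}‖ ≤ 132^d·264·C_T(d)` on the fat region, all `n`, all `l` (`Σ_{l′}‖U_{l′}‖ ≤ 132^d`). [folklore] -/
theorem norm_sum_Afac_le {r : ℝ} (hr : r ≤ 1 / 4) (hdr : (d : ℝ) * r ^ 2 ≤ 1 / 16) {q : Fin d → ℂ}
    (hq : q ∈ Fat d r) (μ : Fin d) (k : Fin d → Fin n) :
    ‖∑ k' ∈ univ.erase k, Afac n μ k k' q‖ ≤ 132 ^ d * (264 * CT163 d) := by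
  have hC := CT163_nonneg d
  calc ‖∑ k' ∈ univ.erase k, Afac n μ k k' q‖
      ≤ ∑ k' ∈ univ.erase k, ‖Afac n μ k k' q‖ := norm_sum_le _ _
    _ ≤ ∑ k' ∈ univ.erase k, ‖U n k' q‖ * (264 * CT163 d) :=
        Finset.sum_le_sum (fun k' hk' => norm_Afac_le n hr hdr hq μ k k' (Finset.ne_of_mem_erase hk'))
    _ ≤ ∑ k' : Fin d → Fin n, ‖U n k' q‖ * (264 * CT163 d) :=
        Finset.sum_le_sum_of_subset_of_nonneg (Finset.erase_subset _ _)
          (fun _ _ _ => mul_nonneg (norm_nonneg _) (by positivity))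
    _ = (∑ k' : Fin d → Fin n, ‖U n k' q‖) * (264 * CT163 d) := by rw [Finset.sum_mul]
    _ ≤ 132 ^ d * (264 * CT163 d) := mul_le_mul_of_nonneg_right (sum_norm_U_le n hr hq) (by positivity)

/-- the lower constants of §4: `c_Y = (4/π²)^{d+1}/2`, `c_N = (4/π²)^d/2`, `c_F = ((4/π²)^d)^d/2`. [folklore] -/
def cY163 (d : ℕ) : ℝ := (4 / Real.pi ^ 2) ^ (d + 1) / 2

/-- the lower constant `c_N = (4/π²)^d/2` of `𝒩` (§4). [folklore] -/
def cN163 (d : ℕ) : ℝ := (4 / Real.pi ^ 2) ^ d / 2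

/-- the lower constant `c_F = ((4/π²)^d)^d/2` of `F` (§4). [folklore] -/
def cF163 (d : ℕ) : ℝ := ((4 / Real.pi ^ 2) ^ d) ^ d / 2

/-- `0 < c_Y`. [folklore] -/
theorem cY163_pos (d : ℕ) : 0 < cY163 d := by unfold cY163; positivity

/-- `0 < c_N`. [folklore] -/
theorem cN163_pos (d : ℕ) : 0 < cN163 d := by unfold cN163; positivity

/-- `0 < c_F`. [folklore] -/
theorem cF163_pos (d : ℕ) : 0 < cF163 d := by unfold cF163; positivity

/-- the head bound `M_head(d) = 2^{d+1}(8d+1)/c_Y`. [folklore] -/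
def Mhead163 (d : ℕ) : ℝ := 2 ^ d * 2 * (8 * d + 1) / cY163 d

/-- the tail bound `M_tail(d) = 4·2^d·132^d·264·C_T/c_N · (2B²)^d/(c_Y c_F)`. [folklore] -/
def Mtail163 (d : ℕ) : ℝ := 4 * 2 ^ d * (132 ^ d * (264 * CT163 d)) / cN163 d * ((2 * Bc d ^ 2) ^ d / (cY163 d * cF163 d))

/-- the direction-factor bound `M_g(d) = 3/c_Y` (`e^κ + 1 ≤ e^{1/4} + 1 ≤ 3`). [folklore] -/
def Mg163 (d : ℕ) : ℝ := 3 / cY163 d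

/-- **THE UNIFORM BOUND** `M₁₆₃(d) = M_head + M_tail·M_g` of the continued (1.63) multiplier. [folklore] -/
def M163 (d : ℕ) : ℝ := Mhead163 d + Mtail163 d * Mg163 d

/-- `0 ≤ M_head`. [folklore] -/
theorem Mhead163_nonneg (d : ℕ) : 0 ≤ Mhead163 d := by
  unfold Mhead163; have := cY163_pos d; positivity

/-- `0 ≤ M_tail`. [folklore] -/
theorem Mtail163_nonneg (d : ℕ) : 0 ≤ Mtail163 d := by
  unfold Mtail163; have := cY163_pos d; have := cN163_pos d; have := cF163_pos d; have := CT163_nonneg d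
  have := Bc_pos d; positivity

/-- `0 ≤ M_g`. [folklore] -/
theorem Mg163_nonneg (d : ℕ) : 0 ≤ Mg163 d := by
  unfold Mg163; have := cY163_pos d; positivity

/-- `‖headC‖ ≤ M_head(d)` on the zero-free strip. [folklore] -/
theorem norm_headC_le {κ : ℝ} (hκ0 : 0 ≤ κ) (hκ : κ ≤ kappa163 d) {p : Fin d → ℂ}
    (hp : p ∈ Strip d κ) (μ : Fin d) (k : Fin d → Fin n) : ‖headC n μ k p‖ ≤ Mhead163 d := by
  have hr := rOf_le d
  have hdr := d_mul_rOf_sq_le d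
  have hq : p ∈ Fat d (rOf d) := strip_subset_fat (rOf_pos d).le (hκ.trans (kappa163_le_rOf d)) hp
  have hY := Yc_lower n hκ0 (hκ.trans (kappa163_le_kappaY d)) μ p hp
  have hd : (0 : ℝ) ≤ d := Nat.cast_nonneg d
  unfold headC Mhead163
  refine norm_div_le_of ?_ (cY163_pos d) hY
  rw [norm_mul, norm_mul]
  have h1 := norm_uCbar_le n hr hq k
  have h2 := norm_vCbar_le n hr hq k μ
  have h3 := norm_rho_le n hr hdr hq k
  calc ‖uCbar n k p‖ * ‖vCbar n k p μ‖ * ‖rho n k p‖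
      ≤ 2 ^ d * 2 * (8 * d + 1) :=
        mul_le_mul (mul_le_mul h1 h2 (norm_nonneg _) (by positivity)) h3 (norm_nonneg _) (by positivity)

/-- `‖tailC‖ ≤ M_tail(d)` on the zero-free strip. [folklore] -/
theorem norm_tailC_le {κ : ℝ} (hκ0 : 0 ≤ κ) (hκ : κ ≤ kappa163 d) {p : Fin d → ℂ}
    (hp : p ∈ Strip d κ) (μ : Fin d) (k : Fin d → Fin n) : ‖tailC n μ k p‖ ≤ Mtail163 d := by
  have hr := rOf_le d
  have hdr := d_mul_rOf_sq_le d
  have hq : p ∈ Fat d (rOf d) := strip_subset_fat (rOf_pos d).le (hκ.trans (kappa163_le_rOf d)) hp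
  obtain ⟨hF, hN, hY, _⟩ := denominators_lower n hκ0 hκ hp
  have hB := one_le_Bc d
  have hC := CT163_nonneg d
  unfold tailC Mtail163
  rw [norm_mul]
  refine mul_le_mul ?_ ?_ (norm_nonneg _) (by have := cN163_pos d; positivity)
  · refine norm_div_le_of ?_ (cN163_pos d) hN
    rw [norm_mul]
    exact mul_le_mul (norm_dC_mul_uCbar_le n hr hq k μ) (norm_sum_Afac_le n hr hdr hq μ k) (norm_nonneg _)
      (by positivity)
  · refine norm_div_le_of ?_ (mul_pos (cY163_pos d) (cF163_pos d)) ?_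
    · exact norm_prod_le_pow _ _ (by nlinarith) (by simp) (fun ν _ => norm_Yc_le n hr hdr hq ν)
    · rw [norm_mul]
      exact mul_le_mul (hY μ) hF (cF163_pos d).le (norm_nonneg _)

/-- `‖gdir_λ‖ ≤ M_g(d)` on the zero-free strip. [folklore] -/
theorem norm_gdir_le {κ : ℝ} (hκ0 : 0 ≤ κ) (hκ : κ ≤ kappa163 d) {p : Fin d → ℂ}
    (hp : p ∈ Strip d κ) (lam : Fin d) : ‖gdir n lam p‖ ≤ Mg163 d := by
  have hY := Yc_lower n hκ0 (hκ.trans (kappa163_le_kappaY d)) lam p hp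
  have hκ4 : κ ≤ 1 / 4 := (hκ.trans (kappa163_le_rOf d)).trans (rOf_le d)
  have exp_half_le_two : Real.exp (1 / 2) ≤ 2 := by
    have h1 : Real.exp (1 / 2) ^ 2 = Real.exp 1 := by
      rw [← Real.exp_nat_mul]; norm_num
    nlinarith [Real.exp_one_lt_d9, Real.exp_pos (1 / 2 : ℝ)]
  have hexp : Real.exp κ + 1 ≤ 3 := by
    have : Real.exp κ ≤ Real.exp (1 / 2) := Real.exp_le_exp.mpr (by linarith)
    linarith [exp_half_le_two]
  unfold gdir Mg163
  exact norm_div_le_of ((norm_expFac_le hp lam).1.trans hexp) (cY163_pos d) hY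

/-- **THE UNIFORM STRIP BOUND**: `‖h163 μ λ l (p′)‖ ≤ M₁₆₃(d)` on `Strip d κ`, `0 ≤ κ ≤ κ₁₆₃(d)`, for every
`n ≥ 1`, every `μ, λ` and EVERY alias index `l` (no decay in `l` claimed). [folklore] -/
theorem norm_h163_le {κ : ℝ} (hκ0 : 0 ≤ κ) (hκ : κ ≤ kappa163 d) {p : Fin d → ℂ}
    (hp : p ∈ Strip d κ) (μ lam : Fin d) (k : Fin d → Fin n) : ‖h163 n μ lam k p‖ ≤ M163 d := by
  have h1 := norm_headC_le n hκ0 hκ hp μ k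
  have h2 := norm_tailC_le n hκ0 hκ hp μ k
  have h3 := norm_gdir_le n hκ0 hκ hp lam
  have h0 := Mhead163_nonneg d
  unfold h163 M163
  refine (norm_add_le _ _).trans (add_le_add ?_ ?_)
  · by_cases hlm : lam = μ
    · simp only [hlm, if_true]; exact h1
    · simp only [hlm, if_false, norm_zero]; exact h0
  · rw [norm_mul]
    exact mul_le_mul h2 h3 (norm_nonneg _) (Mtail163_nonneg d)

end Bounds

end Literature.MathematicalPhysics.QuantumFieldTheory.Balaban1983to89.B5Hk163Strip

end
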